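import Literature.Combinatorics.Designs.ItoArray

/-!
# Negaperiodic Golay pairs of length 2t ⇔ Ito-type (quasi-Williamson) quadruples of order t, for odd t (kernel) —
# the Balonin–Đoković / Schmidt link of the order-334 line, by an elementary CRT splitting

Framing: lottery ticket; floor = certified bounds/negative ranges.

Cell pub-namedobj (venture DiscreteObjects), target (H), hadamard gen 23.  REPLICATION, with our own elementary proof, of
[Balonin–Đoković, Informatsionno-upravliaiushchie sistemy 2015 (5), 2–17 = arXiv:1508.00640, §9 (via Schmidt, Des. Codes
Cryptogr. 17 (1999) and Ito 1981/2000)]: for ODD `t`, negaperiodic Golay pairs of length `2t` (two `±1` sequences whose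
negaperiodic autocorrelations cancel) are equivalent to quasi-Williamson quadruples of order `t` (four `±1` circulants
`A, B, C, D` of order `t` with `A Aᵀ + B Bᵀ + C Cᵀ + D Dᵀ = 4t·I` and `A Bᵀ + C Dᵀ = B Aᵀ + D Cᵀ`, i.e. the Ito-type array
`Literature.Combinatorics.Designs.ItoArray.itoMatrix a b c d` is a Hadamard matrix of order `4t`).  The paper obtains this
through relative difference sets in `ℤ_{4t}` and the dicyclic group of order `8t`; here it is a direct computation.  We use
the tree's form of a negaperiodic pair (gen 19, `Order334NegaPair668`): two `±1` sequences `u, v` on `ZMod n`, `n = 4t`,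
ANTIPERIODIC (`u (x + 2t) = −u x`) with `PAF_u(s) + PAF_v(s) = 0` for `s ∉ {0, 2t}` — the antiperiodic doubling of a
negaperiodic Golay pair of length `2t`.
* THE SPLITTING.  For odd `t`, `ZMod (4t) ≃+* ZMod 4 × ZMod t` (CRT) sends the antiperiod `2t` to `(2, 0)`; an antiperiodic
  `u` is the datum of the two length-`t` sequences `a = u(0, ·)`, `b = u(1, ·)` (`u(2, ·) = −a`, `u(3, ·) = −b`).  Then
  (`sum_antiperiodic_shift0/1/2/3`) `PAF_u(0, r) = 2 (PAF_a + PAF_b)(r) = −PAF_u(2, r)` and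
  `PAF_u(1, r) = 2 (C_{a,b} − C_{b,a})(r) = −PAF_u(3, r)`, `C_{x,y}(r) = Σ_m x(m) y(m + r)` the periodic cross-correlation,
  which is the `(i, i + r)` entry of `circulant x · (circulant y)ᵀ` (`circulant_mul_circT_apply'`).
* **`exists_itoQuadruple_of_negaPair`** (odd `t`, `n = 4t`): an antiperiodic complementary pair on `ZMod n` yields
  `a, b, c, d : ZMod t → ℤ`, `±1`, with `Σ PAF = 0` off `0` (shifts `(0, r)`) AND the amicability
  `A Bᵀ + C Dᵀ = B Aᵀ + D Cᵀ` (shifts `(1, r)`) — a quasi-Williamson quadruple; **`exists_itoHadamard_of_negaPair`**: hence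
  `itoMatrix a b c d` is a Hadamard matrix of order `4t` (Literature `ito_isHadamard`).
* **`exists_negaPair_of_itoQuadruple`** (converse, odd `t`): a quasi-Williamson quadruple of order `t` yields an antiperiodic
  complementary pair on `ZMod (4t)` (glue `a, b, −a, −b` along the CRT), and **`negaPair_iff_itoQuadruple`** (the iff).
At `t = 167` this is the missing link of the order-334 census line (gen 19: an automorphism of pair order 334 of a
hypothetical H(668) ⇒ such a pair on `ZMod 668`; Ito-type H(668) ⇒ an automorphism of pair order 334); the loop is closed in
`Order334ItoTfae668`.  Structure/dictionary only; both sides OPEN at `t = 167`; no order excluded; H(668) untouched.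
Ours (the equivalence itself is the cited published result); no `sorry`, no definitions, default heartbeats.
-/

namespace Summit.Ventures.DiscreteObjects.Hadamard

open Finset BigOperators Matrix

open Literature.Combinatorics.Designs.GoethalsSeidel (IsHadamardMatrix circT circT_apply)
open Literature.Combinatorics.Designs.LegendrePairs (PAF IsPM)
open Literature.Combinatorics.Designs.ItoArray (itoMatrix ito_isHadamard)

/-! ### tools -/

/-- a sum over `ℤ/4` is the sum of the four values -/
lemma zmod4_sum {β : Type*} [AddCommMonoid β] (f : ZMod 4 → β) : ∑ k, f k = f 0 + f 1 + f 2 + f 3 := by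
  have hu : (univ : Finset (ZMod 4)) = {0, 1, 2, 3} := by decide
  rw [hu, Finset.sum_insert (by decide), Finset.sum_insert (by decide), Finset.sum_pair (by decide)]
  simp only [add_assoc]

section cross
variable {t : ℕ}

/-- entries of `X Yᵀ` for two circulants: the periodic CROSS-correlation of the first rows,
`(circulant x · circT y) i k = Σ_m x(m) · y(m + (k − i))`. -/
lemma circulant_mul_circT_apply' [NeZero t] (x y : ZMod t → ℤ) (i k : ZMod t) :
    (circulant x * circT y) i k = ∑ m, x m * y (m + (k - i)) := by
  simp only [mul_apply, circulant_apply, circT_apply]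
  refine Fintype.sum_equiv (Equiv.subLeft i) _ _ (fun j => ?_)
  simp only [Equiv.subLeft_apply]
  congr 1; congr 1; abel

end cross

/-! ### the four shift classes of the periodic autocorrelation of an antiperiodic function on `ℤ/4 × ℤ/t` -/

section split
variable {t : ℕ} [NeZero t] (U : ZMod 4 × ZMod t → ℤ) (hU : ∀ k j, U (k + 2, j) = -U (k, j))
include hU

omit [NeZero t] in
/-- the values on the cosets `2, 3` are minus those on `0, 1` -/
lemma antiperiodic_two_three : (∀ j, U (2, j) = -U (0, j)) ∧ ∀ j, U (3, j) = -U (1, j) := by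
  refine ⟨fun j => ?_, fun j => ?_⟩
  · have h := hU 0 j; rwa [zero_add] at h
  · have h := hU 1 j; rwa [show (1 : ZMod 4) + 2 = 3 by decide] at h

/-- shift `(0, r)`: `PAF_U(0, r) = 2 (PAF_a(r) + PAF_b(r))`, `a = U(0, ·)`, `b = U(1, ·)`. -/
lemma sum_antiperiodic_shift0 (r : ZMod t) :
    ∑ p, U p * U (p + (0, r)) = 2 * (PAF (fun j => U (0, j)) r + PAF (fun j => U (1, j)) r) := by
  obtain ⟨h2, h3⟩ := antiperiodic_two_three U hU
  rw [Fintype.sum_prod_type, zmod4_sum]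
  simp only [Prod.mk_add_mk, add_zero, h2, h3, PAF]
  rw [mul_add, Finset.mul_sum, Finset.mul_sum, ← Finset.sum_add_distrib, ← Finset.sum_add_distrib,
    ← Finset.sum_add_distrib, ← Finset.sum_add_distrib]
  exact Finset.sum_congr rfl (fun j _ => by ring)

/-- shift `(1, r)`: `PAF_U(1, r) = 2 (C_{a,b}(r) − C_{b,a}(r))`. -/
lemma sum_antiperiodic_shift1 (r : ZMod t) :
    ∑ p, U p * U (p + (1, r)) = 2 * (∑ j, U (0, j) * U (1, j + r) - ∑ j, U (1, j) * U (0, j + r)) := by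
  obtain ⟨h2, h3⟩ := antiperiodic_two_three U hU
  rw [Fintype.sum_prod_type, zmod4_sum]
  simp only [Prod.mk_add_mk, zero_add, show (1 : ZMod 4) + 1 = 2 by decide, show (2 : ZMod 4) + 1 = 3 by decide,
    show (3 : ZMod 4) + 1 = 0 by decide, h2, h3]
  rw [mul_sub, Finset.mul_sum, Finset.mul_sum, ← Finset.sum_add_distrib, ← Finset.sum_add_distrib,
    ← Finset.sum_add_distrib, ← Finset.sum_sub_distrib]
  exact Finset.sum_congr rfl (fun j _ => by ring)

/-- shift `(2, r)`: `PAF_U(2, r) = −2 (PAF_a(r) + PAF_b(r))`. -/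
lemma sum_antiperiodic_shift2 (r : ZMod t) :
    ∑ p, U p * U (p + (2, r)) = -(2 * (PAF (fun j => U (0, j)) r + PAF (fun j => U (1, j)) r)) := by
  obtain ⟨h2, h3⟩ := antiperiodic_two_three U hU
  rw [Fintype.sum_prod_type, zmod4_sum]
  simp only [Prod.mk_add_mk, zero_add, show (1 : ZMod 4) + 2 = 3 by decide, show (2 : ZMod 4) + 2 = 0 by decide,
    show (3 : ZMod 4) + 2 = 1 by decide, h2, h3, PAF]
  rw [mul_add, Finset.mul_sum, Finset.mul_sum, ← Finset.sum_add_distrib, ← Finset.sum_add_distrib,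
    ← Finset.sum_add_distrib, ← Finset.sum_add_distrib, ← Finset.sum_neg_distrib]
  exact Finset.sum_congr rfl (fun j _ => by ring)

/-- shift `(3, r)`: `PAF_U(3, r) = −2 (C_{a,b}(r) − C_{b,a}(r))`. -/
lemma sum_antiperiodic_shift3 (r : ZMod t) :
    ∑ p, U p * U (p + (3, r)) = -(2 * (∑ j, U (0, j) * U (1, j + r) - ∑ j, U (1, j) * U (0, j + r))) := by
  obtain ⟨h2, h3⟩ := antiperiodic_two_three U hU
  rw [Fintype.sum_prod_type, zmod4_sum]
  simp only [Prod.mk_add_mk, zero_add, show (1 : ZMod 4) + 3 = 0 by decide, show (2 : ZMod 4) + 3 = 1 by decide,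
    show (3 : ZMod 4) + 3 = 2 by decide, h2, h3]
  rw [mul_sub, Finset.mul_sum, Finset.mul_sum, ← Finset.sum_add_distrib, ← Finset.sum_add_distrib,
    ← Finset.sum_add_distrib, ← Finset.sum_sub_distrib, ← Finset.sum_neg_distrib]
  exact Finset.sum_congr rfl (fun j _ => by ring)

end split

/-! ### transport of the periodic autocorrelation along an additive equivalence -/

section transport
variable {n t : ℕ} [NeZero n] [NeZero t]

/-- `PAF_u(s)` read through an additive equivalence `e : ZMod n ≃+ ℤ/4 × ℤ/t`. -/
lemma paf_transport (e : ZMod n ≃+ ZMod 4 × ZMod t) (u : ZMod n → ℤ) (s : ZMod n) :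
    PAF u s = ∑ p, u (e.symm p) * u (e.symm (p + e s)) := by
  calc PAF u s = ∑ i, u i * u (i + s) := rfl
    _ = ∑ p, u (e.symm p) * u (e.symm p + s) := (Equiv.sum_comp e.symm.toEquiv (fun i => u i * u (i + s))).symm
    _ = ∑ p, u (e.symm p) * u (e.symm (p + e s)) := by
        refine Finset.sum_congr rfl (fun p _ => ?_)
        rw [map_add, e.symm_apply_apply]

/-- **Core of `⇒`.**  An antiperiodic complementary pair `u, v` on `ZMod n` with antiperiod `h`, read through an additive
equivalence `e : ZMod n ≃+ ℤ/4 × ℤ/t` with `e h = (2, 0)`, gives the quasi-Williamson quadruple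
`a = u ∘ e⁻¹(0, ·)`, `b = u ∘ e⁻¹(1, ·)`, `c = v ∘ e⁻¹(0, ·)`, `d = v ∘ e⁻¹(1, ·)`. -/
theorem exists_itoQuadruple_of_negaPair_equiv (e : ZMod n ≃+ ZMod 4 × ZMod t) (h : ZMod n) (he : e h = (2, 0))
    (u v : ZMod n → ℤ) (hu : IsPM u) (hv : IsPM v) (hua : ∀ x, u (x + h) = -u x) (hva : ∀ x, v (x + h) = -v x)
    (hp : ∀ s : ZMod n, s ≠ 0 → s ≠ h → PAF u s + PAF v s = 0) :
    ∃ a b c d : ZMod t → ℤ, IsPM a ∧ IsPM b ∧ IsPM c ∧ IsPM d ∧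
      (∀ r : ZMod t, r ≠ 0 → PAF a r + PAF b r + PAF c r + PAF d r = 0) ∧
      circulant a * circT b + circulant c * circT d = circulant b * circT a + circulant d * circT c := by
  have hh : e.symm (2, 0) = h := by rw [← he, e.symm_apply_apply]
  have hpair : ∀ (k : ZMod 4) (j : ZMod t), ((k + 2, j) : ZMod 4 × ZMod t) = (k, j) + (2, 0) := fun k j => by
    rw [Prod.mk_add_mk, add_zero]
  have hU : ∀ k j, u (e.symm (k + 2, j)) = -u (e.symm (k, j)) := fun k j => by rw [hpair, map_add, hh, hua]
  have hV : ∀ k j, v (e.symm (k + 2, j)) = -v (e.symm (k, j)) := fun k j => by rw [hpair, map_add, hh, hva]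
  -- the autocorrelations at the shifts `e⁻¹(σ, r)`
  have hPu : ∀ q : ZMod 4 × ZMod t, PAF u (e.symm q) = ∑ p, u (e.symm p) * u (e.symm (p + q)) := fun q => by
    rw [paf_transport e u, e.apply_symm_apply]
  have hPv : ∀ q : ZMod 4 × ZMod t, PAF v (e.symm q) = ∑ p, v (e.symm p) * v (e.symm (p + q)) := fun q => by
    rw [paf_transport e v, e.apply_symm_apply]
  -- the shifts `e⁻¹(0, r)`, `r ≠ 0`, and `e⁻¹(1, r)` are admissible
  have hne0 : ∀ (σ : ZMod 4) (r : ZMod t), e.symm (σ, r) = 0 → σ = 0 ∧ r = 0 := fun σ r h0 => by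
    have h1 := congrArg e h0
    rw [e.apply_symm_apply, map_zero] at h1
    exact ⟨by simpa using congrArg Prod.fst h1, by simpa using congrArg Prod.snd h1⟩
  have hneh : ∀ (σ : ZMod 4) (r : ZMod t), e.symm (σ, r) = h → σ = 2 := fun σ r h0 => by
    have h1 := congrArg e h0
    rw [e.apply_symm_apply, he, Prod.mk.injEq] at h1
    exact h1.1
  have hE1 : ∀ r : ZMod t, r ≠ 0 →
      PAF (fun j => u (e.symm (0, j))) r + PAF (fun j => u (e.symm (1, j))) r +
        PAF (fun j => v (e.symm (0, j))) r + PAF (fun j => v (e.symm (1, j))) r = 0 := by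
    intro r hr
    have h0 := hp (e.symm (0, r)) (fun h1 => hr (hne0 0 r h1).2) (fun h1 => absurd (hneh 0 r h1) (by decide))
    rw [hPu, hPv, sum_antiperiodic_shift0 (fun p => u (e.symm p)) hU r,
      sum_antiperiodic_shift0 (fun p => v (e.symm p)) hV r] at h0
    linarith
  have hE2 : ∀ r : ZMod t,
      ∑ j, u (e.symm (0, j)) * u (e.symm (1, j + r)) + ∑ j, v (e.symm (0, j)) * v (e.symm (1, j + r)) =
        ∑ j, u (e.symm (1, j)) * u (e.symm (0, j + r)) + ∑ j, v (e.symm (1, j)) * v (e.symm (0, j + r)) := by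
    intro r
    have h0 := hp (e.symm (1, r)) (fun h1 => absurd (hne0 1 r h1).1 (by decide))
      (fun h1 => absurd (hneh 1 r h1) (by decide))
    rw [hPu, hPv, sum_antiperiodic_shift1 (fun p => u (e.symm p)) hU r,
      sum_antiperiodic_shift1 (fun p => v (e.symm p)) hV r] at h0
    linarith
  refine ⟨fun j => u (e.symm (0, j)), fun j => u (e.symm (1, j)), fun j => v (e.symm (0, j)),
    fun j => v (e.symm (1, j)), fun j => hu _, fun j => hu _, fun j => hv _, fun j => hv _, hE1, ?_⟩
  ext i k
  rw [Matrix.add_apply, Matrix.add_apply, circulant_mul_circT_apply', circulant_mul_circT_apply',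
    circulant_mul_circT_apply', circulant_mul_circT_apply']
  exact hE2 (k - i)

/-- **Core of `⇐`.**  A quasi-Williamson quadruple `a, b, c, d` on `ZMod t` glued along `e : ZMod n ≃+ ℤ/4 × ℤ/t` as
`(a, b, −a, −b)` resp. `(c, d, −c, −d)` on the four cosets is an antiperiodic complementary pair with antiperiod `e⁻¹(2, 0)`. -/
theorem exists_negaPair_of_itoQuadruple_equiv (e : ZMod n ≃+ ZMod 4 × ZMod t) (h : ZMod n) (he : e h = (2, 0))
    (a b c d : ZMod t → ℤ) (ha : IsPM a) (hb : IsPM b) (hc : IsPM c) (hd : IsPM d)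
    (hs : ∀ r : ZMod t, r ≠ 0 → PAF a r + PAF b r + PAF c r + PAF d r = 0)
    (hab : circulant a * circT b + circulant c * circT d = circulant b * circT a + circulant d * circT c) :
    ∃ u v : ZMod n → ℤ, IsPM u ∧ IsPM v ∧ (∀ x, u (x + h) = -u x) ∧ (∀ x, v (x + h) = -v x) ∧
      ∀ s : ZMod n, s ≠ 0 → s ≠ h → PAF u s + PAF v s = 0 := by
  have zmod4_cases : ∀ k : ZMod 4, k = 0 ∨ k = 1 ∨ k = 2 ∨ k = 3 := by decide
  -- the glued functions on `ℤ/4 × ℤ/t`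
  set W : (ZMod t → ℤ) → (ZMod t → ℤ) → ZMod 4 × ZMod t → ℤ := fun x y p =>
    if p.1 = 0 then x p.2 else if p.1 = 1 then y p.2 else if p.1 = 2 then -x p.2 else -y p.2 with hW
  have W0 : ∀ x y j, W x y (0, j) = x j := fun x y j => by
    rw [hW]; dsimp only; rw [if_pos rfl]
  have W1 : ∀ x y j, W x y (1, j) = y j := fun x y j => by
    rw [hW]; dsimp only; rw [if_neg (show (1 : ZMod 4) ≠ 0 by decide), if_pos rfl]
  have W2 : ∀ x y j, W x y (2, j) = -x j := fun x y j => by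
    rw [hW]; dsimp only
    rw [if_neg (show (2 : ZMod 4) ≠ 0 by decide), if_neg (show (2 : ZMod 4) ≠ 1 by decide), if_pos rfl]
  have W3 : ∀ x y j, W x y (3, j) = -y j := fun x y j => by
    rw [hW]; dsimp only
    rw [if_neg (show (3 : ZMod 4) ≠ 0 by decide), if_neg (show (3 : ZMod 4) ≠ 1 by decide),
      if_neg (show (3 : ZMod 4) ≠ 2 by decide)]
  have Wanti : ∀ x y k j, W x y (k + 2, j) = -W x y (k, j) := fun x y k j => by
    rcases zmod4_cases k with rfl | rfl | rfl | rfl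
    · rw [zero_add, W2, W0]
    · rw [show (1 : ZMod 4) + 2 = 3 by decide, W3, W1]
    · rw [show (2 : ZMod 4) + 2 = 0 by decide, W0, W2, neg_neg]
    · rw [show (3 : ZMod 4) + 2 = 1 by decide, W1, W3, neg_neg]
  have Wpm : ∀ x y, IsPM x → IsPM y → ∀ p, W x y p = 1 ∨ W x y p = -1 := by
    intro x y hx hy p
    obtain ⟨k, j⟩ := p
    have hneg : ∀ z : ℤ, (z = 1 ∨ z = -1) → (-z = 1 ∨ -z = -1) := fun z hz => by
      rcases hz with rfl | rfl <;> norm_num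
    rcases zmod4_cases k with rfl | rfl | rfl | rfl
    · rw [W0]; exact hx j
    · rw [W1]; exact hy j
    · rw [W2]; exact hneg _ (hx j)
    · rw [W3]; exact hneg _ (hy j)
  have hh : e.symm (2, 0) = h := by rw [← he, e.symm_apply_apply]
  -- the cross-correlation identity from amicability, at the entry `(0, r)`
  have hE2 : ∀ r : ZMod t, ∑ m, a m * b (m + r) + ∑ m, c m * d (m + r) = ∑ m, b m * a (m + r) + ∑ m, d m * c (m + r) := by
    intro r
    have h0 := congrFun (congrFun hab 0) r
    rw [Matrix.add_apply, Matrix.add_apply, circulant_mul_circT_apply', circulant_mul_circT_apply',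
      circulant_mul_circT_apply', circulant_mul_circT_apply', sub_zero] at h0
    exact h0
  refine ⟨fun x => W a b (e x), fun x => W c d (e x), fun x => Wpm a b ha hb (e x), fun x => Wpm c d hc hd (e x),
    fun x => ?_, fun x => ?_, fun s hs0 hsh => ?_⟩
  · have h1 : e (x + h) = ((e x).1 + 2, (e x).2) := by rw [map_add, he]; ext <;> simp
    show W a b (e (x + h)) = -W a b (e x)
    rw [h1, Wanti]
  · have h1 : e (x + h) = ((e x).1 + 2, (e x).2) := by rw [map_add, he]; ext <;> simp
    show W c d (e (x + h)) = -W c d (e x)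
    rw [h1, Wanti]
  · -- write `s = e⁻¹(σ, r)` and split by `σ`
    obtain ⟨σ, r, rfl⟩ : ∃ (σ : ZMod 4) (r : ZMod t), s = e.symm (σ, r) := ⟨(e s).1, (e s).2, by
      rw [Prod.mk.eta, e.symm_apply_apply]⟩
    have hPu : PAF (fun x => W a b (e x)) (e.symm (σ, r)) = ∑ p, W a b p * W a b (p + (σ, r)) := by
      rw [paf_transport e, e.apply_symm_apply]
      simp only [e.apply_symm_apply]
    have hPv : PAF (fun x => W c d (e x)) (e.symm (σ, r)) = ∑ p, W c d p * W c d (p + (σ, r)) := by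
      rw [paf_transport e, e.apply_symm_apply]
      simp only [e.apply_symm_apply]
    rw [hPu, hPv]
    rcases zmod4_cases σ with rfl | rfl | rfl | rfl
    · have hr : r ≠ 0 := fun hr => hs0 (by rw [hr, ← Prod.zero_eq_mk, map_zero])
      rw [sum_antiperiodic_shift0 (W a b) (Wanti a b) r, sum_antiperiodic_shift0 (W c d) (Wanti c d) r]
      simp only [W0, W1]
      have := hs r hr
      linarith
    · rw [sum_antiperiodic_shift1 (W a b) (Wanti a b) r, sum_antiperiodic_shift1 (W c d) (Wanti c d) r]
      simp only [W0, W1]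
      have := hE2 r
      linarith
    · have hr : r ≠ 0 := fun hr => hsh (by rw [hr, hh])
      rw [sum_antiperiodic_shift2 (W a b) (Wanti a b) r, sum_antiperiodic_shift2 (W c d) (Wanti c d) r]
      simp only [W0, W1]
      have := hs r hr
      linarith
    · rw [sum_antiperiodic_shift3 (W a b) (Wanti a b) r, sum_antiperiodic_shift3 (W c d) (Wanti c d) r]
      simp only [W0, W1]
      have := hE2 r
      linarith

end transport

/-! ### the CRT instance: `n = 4t`, `t` odd, antiperiod `2t` -/

section crt
variable {n t : ℕ} [NeZero n] [NeZero t]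

omit [NeZero n] in
/-- for odd `t` and `n = 4t`: the CRT equivalence `ZMod n ≃+* ℤ/4 × ℤ/t` sends `2t` to `(2, 0)`. -/
lemma crt_two_mul (hn : n = 4 * t) (ht : Odd t) :
    ∃ e : ZMod n ≃+ ZMod 4 × ZMod t, e ((2 * t : ℕ) : ZMod n) = (2, 0) := by
  have hcop : Nat.Coprime 4 t := (Nat.coprime_two_left.mpr ht).pow_left 2
  let e : ZMod n ≃+* ZMod 4 × ZMod t := (ZMod.ringEquivCongr hn).trans (ZMod.chineseRemainder hcop)
  refine ⟨e.toAddEquiv, ?_⟩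
  show e ((2 * t : ℕ) : ZMod n) = (2, 0)
  have hmod : (2 * t) % 4 = 2 := by obtain ⟨k, rfl⟩ := ht; omega
  rw [map_natCast]
  ext
  · rw [Prod.fst_natCast, ← ZMod.natCast_mod (2 * t) 4, hmod, Nat.cast_ofNat]
  · rw [Prod.snd_natCast, Nat.cast_mul, ZMod.natCast_self, mul_zero]

/-- **Negaperiodic Golay pair of length `2t` ⇒ quasi-Williamson quadruple of order `t` (odd `t`).**  If `u, v` are `±1`
sequences on `ZMod n`, `n = 4t`, antiperiodic of antiperiod `2t`, with `PAF_u(s) + PAF_v(s) = 0` for all `s ∉ {0, 2t}`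
(the antiperiodic doubling of a negaperiodic Golay pair of length `2t`), then there are `±1` sequences `a, b, c, d` on
`ZMod t` with `PAF_a + PAF_b + PAF_c + PAF_d = 0` off `0` whose circulants satisfy `A Bᵀ + C Dᵀ = B Aᵀ + D Cᵀ`.
Replication of [Balonin–Đoković 2015, §9] (t odd); our proof by the CRT splitting. -/
theorem exists_itoQuadruple_of_negaPair (hn : n = 4 * t) (ht : Odd t) (u v : ZMod n → ℤ) (hu : IsPM u) (hv : IsPM v)
    (hua : ∀ x, u (x + (2 * t : ℕ)) = -u x) (hva : ∀ x, v (x + (2 * t : ℕ)) = -v x)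
    (hp : ∀ s : ZMod n, s ≠ 0 → s ≠ (2 * t : ℕ) → PAF u s + PAF v s = 0) :
    ∃ a b c d : ZMod t → ℤ, IsPM a ∧ IsPM b ∧ IsPM c ∧ IsPM d ∧
      (∀ r : ZMod t, r ≠ 0 → PAF a r + PAF b r + PAF c r + PAF d r = 0) ∧
      circulant a * circT b + circulant c * circT d = circulant b * circT a + circulant d * circT c := by
  obtain ⟨e, he⟩ := crt_two_mul hn ht
  exact exists_itoQuadruple_of_negaPair_equiv e _ he u v hu hv hua hva hp

/-- **… hence an Ito-type Hadamard matrix of order `4t`** (Literature `ito_isHadamard`, [Balonin–Đoković 2015, §9]). -/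
theorem exists_itoHadamard_of_negaPair (hn : n = 4 * t) (ht : Odd t) (u v : ZMod n → ℤ) (hu : IsPM u) (hv : IsPM v)
    (hua : ∀ x, u (x + (2 * t : ℕ)) = -u x) (hva : ∀ x, v (x + (2 * t : ℕ)) = -v x)
    (hp : ∀ s : ZMod n, s ≠ 0 → s ≠ (2 * t : ℕ) → PAF u s + PAF v s = 0) :
    ∃ a b c d : ZMod t → ℤ, IsHadamardMatrix (itoMatrix a b c d) := by
  obtain ⟨a, b, c, d, ha, hb, hc, hd, hs, hab⟩ := exists_itoQuadruple_of_negaPair hn ht u v hu hv hua hva hp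
  exact ⟨a, b, c, d, ito_isHadamard a b c d ha hb hc hd hs hab⟩

/-- **Quasi-Williamson quadruple of order `t` ⇒ negaperiodic Golay pair of length `2t` (odd `t`)**, in the antiperiodic
form on `ZMod (4t)`.  Replication of the converse in [Balonin–Đoković 2015, §9]; our proof by the CRT gluing. -/
theorem exists_negaPair_of_itoQuadruple (hn : n = 4 * t) (ht : Odd t) (a b c d : ZMod t → ℤ)
    (ha : IsPM a) (hb : IsPM b) (hc : IsPM c) (hd : IsPM d)
    (hs : ∀ r : ZMod t, r ≠ 0 → PAF a r + PAF b r + PAF c r + PAF d r = 0)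
    (hab : circulant a * circT b + circulant c * circT d = circulant b * circT a + circulant d * circT c) :
    ∃ u v : ZMod n → ℤ, IsPM u ∧ IsPM v ∧ (∀ x, u (x + (2 * t : ℕ)) = -u x) ∧ (∀ x, v (x + (2 * t : ℕ)) = -v x) ∧
      ∀ s : ZMod n, s ≠ 0 → s ≠ (2 * t : ℕ) → PAF u s + PAF v s = 0 := by
  obtain ⟨e, he⟩ := crt_two_mul hn ht
  exact exists_negaPair_of_itoQuadruple_equiv e _ he a b c d ha hb hc hd hs hab

/-- **Negaperiodic Golay pairs of length `2t` ⇔ quasi-Williamson (Ito-type) quadruples of order `t`, `t` odd**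
[Balonin–Đoković 2015, §9; Schmidt 1999] — kernel form on the antiperiodic doubling. -/
theorem negaPair_iff_itoQuadruple (hn : n = 4 * t) (ht : Odd t) :
    (∃ u v : ZMod n → ℤ, IsPM u ∧ IsPM v ∧ (∀ x, u (x + (2 * t : ℕ)) = -u x) ∧ (∀ x, v (x + (2 * t : ℕ)) = -v x) ∧
      ∀ s : ZMod n, s ≠ 0 → s ≠ (2 * t : ℕ) → PAF u s + PAF v s = 0) ↔
    ∃ a b c d : ZMod t → ℤ, IsPM a ∧ IsPM b ∧ IsPM c ∧ IsPM d ∧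
      (∀ r : ZMod t, r ≠ 0 → PAF a r + PAF b r + PAF c r + PAF d r = 0) ∧
      circulant a * circT b + circulant c * circT d = circulant b * circT a + circulant d * circT c := by
  constructor
  · rintro ⟨u, v, hu, hv, hua, hva, hp⟩
    exact exists_itoQuadruple_of_negaPair hn ht u v hu hv hua hva hp
  · rintro ⟨a, b, c, d, ha, hb, hc, hd, hs, hab⟩
    exact exists_negaPair_of_itoQuadruple hn ht a b c d ha hb hc hd hs hab

end crt

end Summit.Ventures.DiscreteObjects.Hadamard
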